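import Literature.IUT.HodgeTheaters.ThetaNFHodgeTheaters
import Literature.IUT.HodgeTheaters.FrobenioidBridgeModelsWitness
import HarnessLib

/-!
# [IUTchI] Cor. 5.6 (i): the predicate `S5Local.Cor56i` is a SCHEMA — universal-closure certificate (proof-only)

S. Mochizuki, *Inter-universal Teichmüller theory I*, kurims manuscript (May 2020), §5, Corollary 5.6 (i) p. 153 ("the
natural functorially induced map from the set of isomorphisms between two Θ-Hodge theaters to the set of isomorphisms
between the respective associated `𝒟`-prime-strips is bijective") [claim: Mochizuki2012, status: disputed]
(IUTchI §5 Cor 5.6 (i), kurims p.153).  abc-iut cell, FACT-LIST row **F-2045** of layer L5 (seat abc-iut-w6-d089 gen 5,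
row «KL5-CLOSURE-CERTS-2»).  PROOF-ONLY companion of abc-iut-L5-t3's `ThetaNFHodgeTheaters.lean` (no `def`, no `instance`,
nothing re-typed).

The row was «LABEL-OPEN, conditional/instance events only» (plan/LF-KERNEL-STATUS 2026-08-27T02:19Z): conditional
closers `cor56i_of_rigid` / `cor56i_of_cor56iKit` / `cor56i_of_canonical_laws` (the Cor. 5.3 rigidity inputs) exist, a
universal-closure decision did not.  `Cor56i S` is a statement about an ARBITRARY stub `S : S5Local 𝔡`, whose fields
`ThetaHT` (a groupoid of Θ-Hodge theaters), `assocStrip`, `assocStripIso` (the tautologically associated `ℱ`-prime-strip,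
on objects and on isomorphisms) are free data.  At the tree's own KIT-RULE witness `toyS5Local` (abc-iut-L5,
`FrobenioidBridgeModelsWitness.lean`) the groupoid of Θ-Hodge theaters is the one-object groupoid `SingleObj (𝔽_5^⋇)` — TWO
automorphisms (`card_flStar`: `|𝔽_5^⋇| = 5^⋇ = 2`) — while `assocStripIso` is constantly `Iso.refl`: the map of Cor. 5.6 (i)
is constant on a two-element set, hence not injective.

* `not_cor56i_of_assocStripIso_eq` — WHICH DEGENERATION KILLS THE CLAUSE: two distinct isomorphisms of Θ-Hodge theaters
  with the same associated strip isomorphism falsify `Cor56i`;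
* `not_cor56i_toyS5Local` — the toy stub is such a datum; `not_forall_cor56i` — **F-2045 is a schema**: its universal
  closure is FALSE; the content is the conditional closers above (instance forms at kits: `thick_cor56i`, …).

HONEST FRAMING: a refuted universal closure is a statement about OUR stub admitting inhabitants whose Θ-Hodge-theater
isomorphisms are not read off the associated strips — not about print's Cor. 5.6 (i), whose Θ-Hodge theaters are the
genuine ones of [IUTchI] Def. 3.6 (there the map is injective by the rigidity of Cor. 5.3).  Nothing here bears on
[IUTchIII] Cor. 3.12 or takes a side; typed ≠ proved; refuted-as-typed ≠ refuted-in-print.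
-/

namespace Literature.IUT.HodgeTheaters

namespace BaseThetaDatum

open CategoryTheory TrivialModel

universe u

namespace S5Local

variable {𝔡 : BaseThetaDatum.{u}} (S : S5Local 𝔡)

/-- **IUTchI:Cor5.6(i)** (kurims p.153) fails over any stub possessing two DISTINCT isomorphisms `e ≠ e'` of Θ-Hodge
theaters with the same associated `ℱ`-prime-strip isomorphism (then the induced `𝒟`-prime-strip isomorphisms agree too,
so the map of Cor. 5.6 (i) is not injective). [claim: Mochizuki2012, status: disputed] (IUTchI §5 Cor 5.6 (i), kurims p.153) -/
theorem not_cor56i_of_assocStripIso_eq {X Y : S.ThetaHT} (e e' : X ≅ Y) (hne : e ≠ e')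
    (heq : S.assocStripIso e = S.assocStripIso e') : ¬ S.Cor56i := fun h =>
  hne ((h X Y).1 (by
    show (Pi.isoMk fun v => (S.base v).mapIso (S.assocStripIso e v)) =
      Pi.isoMk fun v => (S.base v).mapIso (S.assocStripIso e' v)
    rw [heq]))

end S5Local

/-- **At the KIT-RULE witness `toyS5Local`, Cor. 5.6 (i) as typed FAILS**: `ThetaHT = SingleObj (𝔽_5^⋇)` has the two
automorphisms `globIso 1 ≠ globIso g` (`g ≠ 1`, `|𝔽_5^⋇| = 2`), both sent to `Iso.refl` by `assocStripIso`.
[claim: Mochizuki2012, status: disputed] (IUTchI §5 Cor 5.6 (i), kurims p.153) -/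
theorem not_cor56i_toyS5Local : ¬ toyS5Local.Cor56i := by
  haveI : Fact (Nat.Prime 5) := ⟨Nat.prime_five⟩
  have hcard : Nat.card (FlStar 5) = 2 := by
    rw [card_flStar 5 (by decide)]
    rfl
  haveI : Nontrivial (FlStar 5) := Finite.one_lt_card_iff_nontrivial.mp (by omega)
  obtain ⟨g, hg⟩ := exists_ne (1 : FlStar 5)
  refine toyS5Local.not_cor56i_of_assocStripIso_eq (X := toyS5Local.HT) (Y := toyS5Local.HT)
    (globIso g) (globIso 1) (fun h => hg ?_) rfl
  exact congrArg Iso.hom h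

/-- **F-2045 is a schema**: the universal closure of `BaseThetaDatum.S5Local.Cor56i` is FALSE (already at the base model
`trivialModel` and its KIT-RULE stub `toyS5Local`); the content is the conditional closers `cor56i_of_rigid` /
`cor56i_of_cor56iKit` / `cor56i_of_canonical_laws`. [claim: Mochizuki2012, status: disputed] (IUTchI §5 Cor 5.6 (i), kurims p.153) -/
theorem not_forall_cor56i : ¬ ∀ (𝔡 : BaseThetaDatum.{0}) (S : S5Local 𝔡), S.Cor56i :=
  fun h => not_cor56i_toyS5Local (h trivialModel toyS5Local)

/-- The row is a SCHEMA in the cell's sense: over one and the same base model the predicate fails for one stub (the toy)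
— while the tree's conditional closers produce it from the Cor. 5.3 rigidity inputs elsewhere.
[claim: Mochizuki2012, status: disputed] (IUTchI §5 Cor 5.6 (i), kurims p.153) -/
theorem exists_s5Local_not_cor56i : ∃ S : S5Local trivialModel, ¬ S.Cor56i :=
  ⟨toyS5Local, not_cor56i_toyS5Local⟩

end BaseThetaDatum

end Literature.IUT.HodgeTheaters
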